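import Literature.Topology.FourManifolds.InvolutiveCorkDecompositionProofs
import Literature.Topology.FourManifolds.CorkDecompositionMiddleLevelOfBasisTheorem
import HarnessLib

/-!
# The cork decomposition theorem with involution (`matveyev1996_involutiveDecomposition`): staging of the discharge

Topic `Literature/Topology/FourManifolds` (fact seat
`provefact-Literature.Topology.FourManifolds.matveyev1996_involutiveDecomposition`), sibling
"Proofs" file of `CorkDecompositionInvolutive.lean`, which states the named fact
`Literature.Topology.FourManifolds.matveyev1996_involutiveDecomposition`: R. Kirby, *Akbulut's corks
and h-cobordisms of smooth, simply connected 4-manifolds*, Turkish J. Math. 20 (1996) 85–93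
(arXiv:math/9712231), Theorem with **Addendum (D)** — h-cobordant simply connected closed smooth
4-manifolds are `X₁ = C ∪_φ W`, `X₂ = C ∪_{φ ∘ τ} W` for a compact contractible `C` and an
INVOLUTION `τ` of `∂C`.  Everything here is proved; no definition and no named fact is introduced
(net debt `0`).

## State of the fact

The tree carries the same statement twice, up to the order of two existential binders:
`matveyev1996_involutiveDecomposition` (`CorkDecompositionInvolutive.lean`) and
`Literature.Topology.FourManifolds.involutiveCorkDecomposition` (`InvolutiveCorkDecomposition.lean`);
their equivalence and the whole of Kirby's proof of Addendum (D) above Matveyev's part 1 with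
Fact 1 — the connected-sum manipulation of Matveyev's proof of part 2 (J. Differential Geom. 44
(1996), p. 3, fig. 2) re-run on the explicit seam-side data of `CorkDecompositionSplittingProof.lean`
so that the twist of `∂(W₁ ♮ W₂) = Σ₁ # Σ₂` is computed (`ψ` on the punctured `Σ₁`, `ψ⁻¹` on the
punctured `Σ₂`: Kirby's "obvious involution", loc. cit. §5) — are the theorems
`involutiveCorkDecomposition_iff_matveyev1996_involutiveDecomposition`,
`involutiveCorkDecomposition_of_partOne_and_fact` and
`matveyev1996_involutiveDecomposition_of_partOne_and_fact` of
`InvolutiveCorkDecompositionProofs.lean`.  Hence `matveyev1996_involutiveDecomposition` has exactly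
the frontier of the plain cork theorem `Literature.Topology.FourManifolds.corkDecomposition`
(`CorkDecompositionSplit.lean`): the node
`Literature.Topology.FourManifolds.Matveyev1996_partOne_and_fact` (Matveyev's Theorem part 1 with
Fact 1: the 5-dimensional h-cobordism content), i.e. its two open leaves

1. `Literature.Topology.FourManifolds.Cobordism.Milnor1965_basisTheorem_slab` — Milnor, *Lectures on
   the h-cobordism theorem* (1965), Thm. 7.6 on a slab (giving rung (B), the middle level, by
   `exists_dualSpheres_middleLevel_of_two_three_of_basisTheorem`), and
2. `Literature.Topology.FourManifolds.Matveyev1996_partOne_and_fact_of_dualSpheres` — (H4), the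
   four-dimensional construction from the middle level on (Matveyev pp. 1–3 with Fact 1; Kirby
   1996 §3 and Addenda (B), (C)).

This file records the two resulting stagings of the discharge for THIS fact name:

* `Literature.Topology.FourManifolds.matveyev1996_involutiveDecomposition_of_middleLevel_leaves` —
  from (B) as a fact and (H4);
* `Literature.Topology.FourManifolds.matveyev1996_involutiveDecomposition_holds_of` — from the two
  leaves 1–2; once they are discharged,
  `theorem matveyev1996_involutiveDecomposition_holds : matveyev1996_involutiveDecomposition :=
  matveyev1996_involutiveDecomposition_holds_of Cobordism.Milnor1965_basisTheorem_slab_holds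
  Matveyev1996_partOne_and_fact_of_dualSpheres_holds` is to be appended here;

and the faithfulness certificate `corkDecomposition_of_matveyev1996_involutiveDecomposition`
(the involutive form refines the one-piece cork theorem).

## References

* R. Kirby, *Akbulut's corks and h-cobordisms of smooth, simply connected 4-manifolds*, Turkish
  J. Math. 20 (1996) 85–93; arXiv:math/9712231: Theorem, Addendum (D) (p. 1) and its proof (§5).
  [KirbyCorks1996]
* R. Matveyev, *A decomposition of smooth simply-connected h-cobordant 4-manifolds*,
  J. Differential Geom. 44 (1996) 571–582; arXiv:dg-ga/9505001: Theorem 1, Fact 1, proof of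
  part 2 with fig. 2 (pp. 1–3). [Matveyev1996]
* J. Milnor, *Lectures on the h-cobordism theorem* (1965), Thm. 7.6, Thm. 8.1. [MilnorHCobordism1965]
-/

noncomputable section

namespace Literature.Topology.FourManifolds

/-- **The involutive cork theorem (`matveyev1996_involutiveDecomposition`) from the two
Matveyev-specific leaves (B) and (H4)**: the middle level of the two-three handlebody
(`exists_dualSpheres_middleLevel_of_two_three`) and the four-dimensional construction from the
middle level on with Fact 1 (`Matveyev1996_partOne_and_fact_of_dualSpheres`) give Matveyev's
part 1 with Fact 1 (`matveyev1996_partOne_and_fact_of_middleLevel_leaves`, Milnor's Thm. 8.1 at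
the incoming end being discharged), whence the involutive form by Kirby's Addendum (D)
(`matveyev1996_involutiveDecomposition_of_partOne_and_fact`).
[cite: KirbyCorks1996, Theorem and Addendum (D), §§2–5 (arXiv:math/9712231)]
[cite: Matveyev1996, Theorem 1 and its proof, Fact 1 (arXiv pp. 1–3)] -/
theorem matveyev1996_involutiveDecomposition_of_middleLevel_leaves
    (hB : exists_dualSpheres_middleLevel_of_two_three.{0})
    (h4 : Matveyev1996_partOne_and_fact_of_dualSpheres.{0}) :
    matveyev1996_involutiveDecomposition :=
  matveyev1996_involutiveDecomposition_of_partOne_and_fact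
    (matveyev1996_partOne_and_fact_of_middleLevel_leaves hB h4)

/-- **Staging of the discharge of `matveyev1996_involutiveDecomposition`**: the fact follows from
the two open leaves of the cork DAG, Milnor's Basis Theorem 7.6 on a slab
(`Cobordism.Milnor1965_basisTheorem_slab`, which gives (B) by
`exists_dualSpheres_middleLevel_of_two_three_of_basisTheorem`) and (H4)
(`Matveyev1996_partOne_and_fact_of_dualSpheres`).  `matveyev1996_involutiveDecomposition_holds`
is this theorem applied to their `_holds`.
[cite: KirbyCorks1996, Theorem and Addendum (D), §§2–5 (arXiv:math/9712231)]
[cite: MilnorHCobordism1965, Thm. 7.6 (PDF p. 50) and Thm. 8.1] -/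
theorem matveyev1996_involutiveDecomposition_holds_of
    (h76 : Cobordism.Milnor1965_basisTheorem_slab.{0})
    (h4 : Matveyev1996_partOne_and_fact_of_dualSpheres.{0}) :
    matveyev1996_involutiveDecomposition :=
  matveyev1996_involutiveDecomposition_of_middleLevel_leaves
    (exists_dualSpheres_middleLevel_of_two_three_of_basisTheorem h76) h4

/-- **The involutive form refines the one-piece cork decomposition theorem**
`Literature.Topology.FourManifolds.corkDecomposition` (`CorkTwist.lean`; Curtis–Freedman–Hsiang–Stong
1996, Matveyev 1996), at `Type`: forget that the twist is an involution
(`corkDecomposition_of_involutiveCorkDecomposition` through the equivalence of the two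
renderings). [cite: KirbyCorks1996, Theorem, p. 1 (arXiv:math/9712231)] -/
theorem corkDecomposition_of_matveyev1996_involutiveDecomposition
    (h : matveyev1996_involutiveDecomposition) : corkDecomposition.{0} :=
  corkDecomposition_of_involutiveCorkDecomposition
    (involutiveCorkDecomposition_iff_matveyev1996_involutiveDecomposition.2 h)

/-- **`matveyev1996_involutiveDecomposition` from (H4) alone**: with rung (B) discharged
(`exists_dualSpheres_middleLevel_of_two_three_holds`, from Milnor's Thm. 7.6 on a slab,
`Cobordism.Milnor1965_basisTheorem_slab_holds`), the involutive cork decomposition follows from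
the single remaining leaf `Matveyev1996_partOne_and_fact_of_dualSpheres` (the theorem from the
middle level: Casson moves and Matveyev's Fact 1).  `matveyev1996_involutiveDecomposition_holds`
is this theorem applied to its `_holds`.
[cite: KirbyCorks1996, Theorem and Addendum (D), §§2–5 (arXiv:math/9712231)]
[cite: Matveyev1996, Theorem 1 and its proof, Fact 1 (arXiv pp. 1–3)] -/
theorem matveyev1996_involutiveDecomposition_of_dualSpheres
    (h4 : Matveyev1996_partOne_and_fact_of_dualSpheres.{0}) :
    matveyev1996_involutiveDecomposition :=
  matveyev1996_involutiveDecomposition_of_middleLevel_leaves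
    exists_dualSpheres_middleLevel_of_two_three_holds h4

universe u in
/-- **Matveyev's Theorem 1 with Fact 1 (`Matveyev1996_partOne_and_fact`) from (H4) alone**, rung
(B) being discharged (`exists_dualSpheres_middleLevel_of_two_three_holds`).
[cite: Matveyev1996, Theorem 1 and its proof, Fact 1 (arXiv pp. 1–3)]
[cite: MilnorHCobordism1965, Thm. 7.6 (PDF pp. 50–52) and Thm. 8.1] -/
theorem matveyev1996_partOne_and_fact_of_dualSpheres
    (h4 : Matveyev1996_partOne_and_fact_of_dualSpheres.{u}) :
    Matveyev1996_partOne_and_fact.{u} :=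
  matveyev1996_partOne_and_fact_of_middleLevel_leaves
    exists_dualSpheres_middleLevel_of_two_three_holds h4

end Literature.Topology.FourManifolds

end
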